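import Summits.CriticalPhenomena.PercolationContinuityZ3.Theorems.PercNearOneGluingNoHeavyLowerTailAPLTwoSidedReduction
import HarnessLib

/-!
# `NoHeavyLowerTail` (stmt-CriticalPhenomena-4575) — TWO-SIDED PARALLEL COMPOSITION IV: the transfer inequality for `κ` and the
reduction of U(28/27) to ONE constant-free inequality between connection probabilities

Support file (prover prim-ineq-gen-8 gen 60; `--supports stmt-CriticalPhenomena-4575`; memo
run/shared/lean/prim/prim-ineq-gen-8/FINDING-gen60-TWOSIDED.md §5).  No definitions, no named facts, no sorries.  Notation as in
`…APLTwoSidedReduction.lean`: cells `x = (x₀,B,A,m,τ)`, `y = (y₀,B′,A′,m′,τ′)` (sums `1`), `O_x = x₀+m`, `u_x = 1−p_x = O_x+A`, `v_x = O_x+B`,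
`Q_x = u_xv_x`, `κ_x = O_xτ − AB`; composite `z` (3-terminal union).  THE T-FORM REFERENCES: `x′ := x ⊙ e_{w_y}` with the CONDITIONAL shortcut
`w_y = m′/O_y` (probability that `y` joins `u, v` given that `o` is isolated in `y`) and `y′ := y ⊙ e_{w_x}`, `w_x = m/O_x`.  Then
(`transfer_m_eq`) `O_y·m_{x′} = O_x·m_{y′} = m_z`, and
* **`transfer_kappa_le`** (the transfer inequality, constant-free, NO Harris needed): `κ_z ≤ O_y·κ_{x′} + Q_x·κ_{y′}`, in the polynomial form
  `O_yO_x²κ_z ≤ O_x²·(O_y²κ_{x′}) + O_yQ_x·(O_x²κ_{y′})`; exact remainder `T₁ + T₂ − T₃ − T₄` (`transfer_kappa_eq`) with `T₃ ≤ T₁`, `T₄ ≤ T₂` from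
  `m ≤ O`, `A ≤ u`, `B ≤ v`, `1 − O_y ≤ p_y + π_y` only.
* **`twoSided_of_transfer`**: if `x, y` are valid Harris pieces with `E ≤ 28/27` and the constant-free inequality
  **(b′)** `(√(O_y·p_{x′}π_{x′}) + Q_x·√(p_{y′}π_{y′}/O_x))² ≤ p_zπ_z`
  holds for the pair, then the composite has `E ≤ 28/27`.  Proof: `shortcut_cells_le` for `x′, y′`, the transfer inequality, Cauchy–Schwarz.
So the two-sided composition problem U(28/27) of memos gen 58–60 is REDUCED to (b′) — an inequality about the connection probabilities
`p, π` of `z, x′, y′` alone (no `κ`, no `m` beyond the weights, no `28/27`); (b′) holds on 1.1·10⁶ + 8·10⁴ sampled / adversarial Harris×3 pairs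
(kit j233018; it fails without Harris at the ports), with equality only at `x = id` or `y = id`; it is the general form of the `m → 0`
Cauchy–Schwarz lemma U(∞) of the memo.  (b′) is NOT proved here. [this work]
-/

namespace Summit.CriticalPhenomena.PercolationContinuityZ3.Theorems

namespace APL

/-- `O_y·m_{x′} = m_z` and `O_x·m_{y′} = m_z` in polynomial form: `(y₀+m′)m + m′x₀ = x₀m′ + my₀ + mm′ = (x₀+m)m′ + my₀`. [this work] -/
theorem transfer_m_eq (x0 m y0 m' : ℝ) :
    (y0 + m') * m + m' * x0 = x0 * m' + m * y0 + m * m' ∧ (x0 + m) * m' + m * y0 = x0 * m' + m * y0 + m * m' := by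
  constructor <;> ring

/-- **Exact remainder of the transfer inequality.**  With `O_x = x₀+m`, `O_y = y₀+m′`, `u_x = O_x+A`, `v_x = O_x+B`, `u_y, v_y` likewise,
`O_y²κ_{x′} = O_y²O_xτ + O_ym′O_x(A+B) − y₀²AB`, `O_x²κ_{y′} = O_x²O_yτ′ + O_xmO_y(A′+B′) − x₀²A′B′` and `κ_z` the composite covariance
(`comp_kappa_eq`): `O_x²(O_y²κ_{x′}) + O_y u_xv_x (O_x²κ_{y′}) − O_yO_x²κ_z = T₁ + T₂ − T₃ − T₄` (cells summing to `1`). [this work] -/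
theorem transfer_kappa_eq (x0 B A m τ y0 B' A' m' τ' : ℝ) (hsum : x0 + B + A + m + τ = 1) (hsum' : y0 + B' + A' + m' + τ' = 1) :
    (x0 + m) ^ 2 * ((y0 + m') ^ 2 * (x0 + m) * τ + (y0 + m') * m' * (x0 + m) * (A + B) - y0 ^ 2 * A * B)
      + (y0 + m') * ((x0 + m + A) * (x0 + m + B)) * ((x0 + m) ^ 2 * (y0 + m') * τ' + (x0 + m) * m * (y0 + m') * (A' + B') - x0 ^ 2 * A' * B')
      - (y0 + m') * (x0 + m) ^ 2
        * ((x0 * y0 + (x0 * m' + m * y0 + m * m'))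
            * (τ * (y0 + B' + A' + m' + τ') + (x0 + B + A + m) * τ' + B * (A' + m') + A * (B' + m') + m * (B' + A'))
          - (x0 * A' + A * y0 + A * A') * (x0 * B' + B * y0 + B * B'))
    = (y0 + m') * (x0 + m) ^ 2 * (m' * (B * (x0 + m + A) * (τ' + B') + A * (x0 + m + B) * (τ' + A')) + m * m' * (A' * B + A * B'))
      + (y0 + m') * (x0 + m) * m * (B * B' * (x0 + m + A) * (y0 + m' + A') + A * A' * (x0 + m + B) * (y0 + m' + B'))
      - (x0 + m) ^ 2 * m' ^ 2 * A * B * (B' + A' + τ')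
      - (y0 + m') * m ^ 2 * A' * B' * ((x0 + m) * (A + B) + A * B) := by
  have hx0 : x0 = 1 - B - A - m - τ := by linarith
  have hy0 : y0 = 1 - B' - A' - m' - τ' := by linarith
  subst hx0; subst hy0; ring

/-- **THE TRANSFER INEQUALITY** `κ_z ≤ O_y κ_{x′} + Q_x κ_{y′}` (polynomial form), for arbitrary non-negative cells summing to `1` — no
Harris hypothesis is needed.  (`T₃ ≤ T₁` by `m′ ≤ O_y`, `AB ≤ u_xB`, `AB ≤ v_xA`; `T₄ ≤ T₂` by `m ≤ O_x`, `O_x(A+B) + AB ≤ Bu_x + Av_x`,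
`A′ ≤ u_y`, `B′ ≤ v_y`.) [this work] -/
theorem transfer_kappa_le (x0 B A m τ y0 B' A' m' τ' : ℝ) (h0 : 0 ≤ x0) (hB : 0 ≤ B) (hA : 0 ≤ A) (hm : 0 ≤ m)
    (h0' : 0 ≤ y0) (hB' : 0 ≤ B') (hA' : 0 ≤ A') (hm' : 0 ≤ m') (hτ' : 0 ≤ τ')
    (hsum : x0 + B + A + m + τ = 1) (hsum' : y0 + B' + A' + m' + τ' = 1) :
    (y0 + m') * (x0 + m) ^ 2
        * ((x0 * y0 + (x0 * m' + m * y0 + m * m'))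
            * (τ * (y0 + B' + A' + m' + τ') + (x0 + B + A + m) * τ' + B * (A' + m') + A * (B' + m') + m * (B' + A'))
          - (x0 * A' + A * y0 + A * A') * (x0 * B' + B * y0 + B * B'))
      ≤ (x0 + m) ^ 2 * ((y0 + m') ^ 2 * (x0 + m) * τ + (y0 + m') * m' * (x0 + m) * (A + B) - y0 ^ 2 * A * B)
        + (y0 + m') * ((x0 + m + A) * (x0 + m + B))
          * ((x0 + m) ^ 2 * (y0 + m') * τ' + (x0 + m) * m * (y0 + m') * (A' + B') - x0 ^ 2 * A' * B') := by
  have e := transfer_kappa_eq x0 B A m τ y0 B' A' m' τ' hsum hsum'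
  -- T₃ ≤ T₁ :
  have h3 : (x0 + m) ^ 2 * m' ^ 2 * A * B * (B' + A' + τ')
      ≤ (y0 + m') * (x0 + m) ^ 2 * (m' * (B * (x0 + m + A) * (τ' + B') + A * (x0 + m + B) * (τ' + A'))) := by
    have hm'O : m' ≤ y0 + m' := by linarith
    have hin : A * B * (B' + A' + τ') ≤ B * (x0 + m + A) * (τ' + B') + A * (x0 + m + B) * (τ' + A') := by
      have s1 : B * A * (τ' + B') ≤ B * (x0 + m + A) * (τ' + B') :=
        mul_le_mul_of_nonneg_right (mul_le_mul_of_nonneg_left (by linarith) hB) (add_nonneg hτ' hB')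
      have s2 : A * B * (τ' + A') ≤ A * (x0 + m + B) * (τ' + A') :=
        mul_le_mul_of_nonneg_right (mul_le_mul_of_nonneg_left (by linarith) hA) (add_nonneg hτ' hA')
      have s3 : 0 ≤ A * B * τ' := by positivity
      have s4 : A * B * (B' + A' + τ') = B * A * (τ' + B') + A * B * (τ' + A') - A * B * τ' := by ring
      linarith [s1, s2, s3, s4]
    have hX : 0 ≤ (x0 + m) ^ 2 * m' := by positivity
    calc (x0 + m) ^ 2 * m' ^ 2 * A * B * (B' + A' + τ')
        = ((x0 + m) ^ 2 * m') * (m' * (A * B * (B' + A' + τ'))) := by ring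
      _ ≤ ((x0 + m) ^ 2 * m') * ((y0 + m') * (B * (x0 + m + A) * (τ' + B') + A * (x0 + m + B) * (τ' + A'))) := by
          apply mul_le_mul_of_nonneg_left _ hX
          exact mul_le_mul hm'O hin (by positivity) (by positivity)
      _ = (y0 + m') * (x0 + m) ^ 2 * (m' * (B * (x0 + m + A) * (τ' + B') + A * (x0 + m + B) * (τ' + A'))) := by ring
  -- T₄ ≤ T₂ :
  have h4 : (y0 + m') * m ^ 2 * A' * B' * ((x0 + m) * (A + B) + A * B)
      ≤ (y0 + m') * (x0 + m) * m * (B * B' * (x0 + m + A) * (y0 + m' + A') + A * A' * (x0 + m + B) * (y0 + m' + B')) := by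
    have hmO : m ≤ x0 + m := by linarith
    have hin : A' * B' * ((x0 + m) * (A + B) + A * B) ≤ B * B' * (x0 + m + A) * (y0 + m' + A') + A * A' * (x0 + m + B) * (y0 + m' + B') := by
      -- (x0+m)(A+B) + AB ≤ B(x0+m+A) + A(x0+m+B)  and  A′ ≤ y0+m′+A′, B′ ≤ y0+m′+B′
      have s1 : B * B' * (x0 + m + A) * A' ≤ B * B' * (x0 + m + A) * (y0 + m' + A') :=
        mul_le_mul_of_nonneg_left (by linarith) (by positivity)
      have s2 : A * A' * (x0 + m + B) * B' ≤ A * A' * (x0 + m + B) * (y0 + m' + B') :=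
        mul_le_mul_of_nonneg_left (by linarith) (by positivity)
      have s3 : B * B' * (x0 + m + A) * A' + A * A' * (x0 + m + B) * B' = A' * B' * ((x0 + m) * (A + B) + A * B) + A' * B' * (A * B) := by
        ring
      have s4 : 0 ≤ A' * B' * (A * B) := by positivity
      linarith [s1, s2, s3, s4]
    have hX : 0 ≤ (y0 + m') * m := by positivity
    calc (y0 + m') * m ^ 2 * A' * B' * ((x0 + m) * (A + B) + A * B)
        = ((y0 + m') * m) * (m * (A' * B' * ((x0 + m) * (A + B) + A * B))) := by ring
      _ ≤ ((y0 + m') * m) * ((x0 + m) * (B * B' * (x0 + m + A) * (y0 + m' + A') + A * A' * (x0 + m + B) * (y0 + m' + B'))) := by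
          apply mul_le_mul_of_nonneg_left _ hX
          exact mul_le_mul hmO hin (by positivity) (by positivity)
      _ = (y0 + m') * (x0 + m) * m * (B * B' * (x0 + m + A) * (y0 + m' + A') + A * A' * (x0 + m + B) * (y0 + m' + B')) := by ring
  have h12 : 0 ≤ (y0 + m') * (x0 + m) ^ 2 * (m * m' * (A' * B + A * B')) := by positivity
  have eT1 : (y0 + m') * (x0 + m) ^ 2 * (m' * (B * (x0 + m + A) * (τ' + B') + A * (x0 + m + B) * (τ' + A')) + m * m' * (A' * B + A * B'))
      = (y0 + m') * (x0 + m) ^ 2 * (m' * (B * (x0 + m + A) * (τ' + B') + A * (x0 + m + B) * (τ' + A')))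
        + (y0 + m') * (x0 + m) ^ 2 * (m * m' * (A' * B + A * B')) := by ring
  linarith [e, h3, h4, h12, eT1]

/-- **U(28/27) REDUCED TO THE CONSTANT-FREE INEQUALITY (b′).**  Let `x = (x₀,B,A,m,τ)`, `y = (y₀,B′,A′,m′,τ′)` be valid pieces (cells `≥ 0`,
sums `1`, `O_x = x₀+m > 0`, `O_y = y₀+m′ > 0`) with Harris and `E ≤ 28/27`; let `w_y = m′/O_y`, `w_x = m/O_x` (conditional shortcut weights),
`P₁ = O_y·p_{x′}π_{x′}` and `P₂ = Q_x²·p_{y′}π_{y′}/O_x` with `p_{x′} = τ + B + w_yA`, `π_{x′} = τ + A + w_yB`, `p_{y′} = τ′ + B′ + w_xA′`,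
`π_{y′} = τ′ + A′ + w_xB′`, `Q_x = (x₀+m+A)(x₀+m+B)`, and let `z` be the composite (cells `z_B, z_A, z_m, z_τ`).  IF
`(√P₁ + √P₂)² ≤ p_zπ_z` (the inequality (b′) of memo gen 60 §5), THEN `E(z) ≤ 28/27`.  Proof: `shortcut_cells_le` twice, `transfer_kappa_le`,
`transfer_m_eq`, Cauchy–Schwarz.  Equivalently AM_T: `E(x ⊙ y) ≤ max(E(x ⊙ e_{w_y}), E(y ⊙ e_{w_x}))`. [this work] -/
theorem twoSided_of_transfer (x0 B A m τ y0 B' A' m' τ' zB zA zm zτ P₁ P₂ : ℝ)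
    (h0 : 0 ≤ x0) (hB : 0 ≤ B) (hA : 0 ≤ A) (hm : 0 ≤ m) (hτ : 0 ≤ τ) (hsum : x0 + B + A + m + τ = 1)
    (h0' : 0 ≤ y0) (hB' : 0 ≤ B') (hA' : 0 ≤ A') (hm' : 0 ≤ m') (hτ' : 0 ≤ τ') (hsum' : y0 + B' + A' + m' + τ' = 1)
    (hOx : 0 < x0 + m) (hOy : 0 < y0 + m')
    (hH : (τ + B) * (τ + A) ≤ τ) (hE : (τ - (τ + B) * (τ + A)) ^ 2 ≤ 28 / 27 * ((τ + B) * (τ + A)) * m)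
    (hH' : (τ' + B') * (τ' + A') ≤ τ') (hE' : (τ' - (τ' + B') * (τ' + A')) ^ 2 ≤ 28 / 27 * ((τ' + B') * (τ' + A')) * m')
    (hzB : zB = x0 * B' + B * y0 + B * B') (hzA : zA = x0 * A' + A * y0 + A * A') (hzm : zm = x0 * m' + m * y0 + m * m')
    (hzτ : zτ = τ * (y0 + B' + A' + m' + τ') + (x0 + B + A + m) * τ' + B * (A' + m') + A * (B' + m') + m * (B' + A'))
    (hP₁ : P₁ = (y0 + m') * ((τ + B + m' / (y0 + m') * A) * (τ + A + m' / (y0 + m') * B)))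
    (hP₂ : P₂ = ((x0 + m + A) * (x0 + m + B)) ^ 2 * ((τ' + B' + m / (x0 + m) * A') * (τ' + A' + m / (x0 + m) * B')) / (x0 + m))
    (hb : (Real.sqrt P₁ + Real.sqrt P₂) ^ 2 ≤ (zτ + zB) * (zτ + zA)) :
    (zτ - (zτ + zB) * (zτ + zA)) ^ 2 ≤ 28 / 27 * ((zτ + zB) * (zτ + zA)) * zm := by
  have hC : (0 : ℝ) ≤ 28 / 27 := by norm_num
  obtain ⟨w, hw⟩ : ∃ t : ℝ, t = m' / (y0 + m') := ⟨_, rfl⟩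
  obtain ⟨v, hv⟩ : ∃ t : ℝ, t = m / (x0 + m) := ⟨_, rfl⟩
  have hw0 : 0 ≤ w := by rw [hw]; positivity
  have hw1 : w ≤ 1 := by rw [hw, div_le_one hOy]; linarith
  have hv0 : 0 ≤ v := by rw [hv]; positivity
  have hv1 : v ≤ 1 := by rw [hv, div_le_one hOx]; linarith
  have hwO : (y0 + m') * w = m' := by rw [hw]; field_simp
  have hvO : (x0 + m) * v = m := by rw [hv]; field_simp
  -- the two one-sided shortcuts
  have h1 := shortcut_cells_le x0 B A m τ w h0 hB hA hm hτ hsum hH hE hw0 hw1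
  have h2 := shortcut_cells_le y0 B' A' m' τ' v h0' hB' hA' hm' hτ' hsum' hH' hE' hv0 hv1
  obtain ⟨κ₁, hκ₁⟩ : ∃ t : ℝ, t = τ + w * (A + B) - (τ + B + w * A) * (τ + A + w * B) := ⟨_, rfl⟩
  obtain ⟨κ₂, hκ₂⟩ : ∃ t : ℝ, t = τ' + v * (A' + B') - (τ' + B' + v * A') * (τ' + A' + v * B') := ⟨_, rfl⟩
  rw [← hκ₁] at h1; rw [← hκ₂] at h2
  -- Harris of the shortcuts
  have hx0 : x0 = 1 - B - A - m - τ := by linarith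
  have hy0 : y0 = 1 - B' - A' - m' - τ' := by linarith
  have hκ₁0 : 0 ≤ κ₁ := by
    have e : κ₁ = (τ - (τ + B) * (τ + A)) + w * (A + B) * (x0 + m) + w * A * B * (2 - w) := by rw [hκ₁, hx0]; ring
    have : 0 ≤ w * (A + B) * (x0 + m) + w * A * B * (2 - w) := by
      have : 0 ≤ 2 - w := by linarith
      positivity
    linarith [sub_nonneg.2 hH]
  have hκ₂0 : 0 ≤ κ₂ := by
    have e : κ₂ = (τ' - (τ' + B') * (τ' + A')) + v * (A' + B') * (y0 + m') + v * A' * B' * (2 - v) := by rw [hκ₂, hy0]; ring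
    have : 0 ≤ v * (A' + B') * (y0 + m') + v * A' * B' * (2 - v) := by
      have : 0 ≤ 2 - v := by linarith
      positivity
    linarith [sub_nonneg.2 hH']
  -- the composite covariance and Harris of the composite
  obtain ⟨κz, hκz⟩ : ∃ t : ℝ, t = zτ - (zτ + zB) * (zτ + zA) := ⟨_, rfl⟩
  have eκz : (x0 * y0 + (x0 * m' + m * y0 + m * m'))
        * (τ * (y0 + B' + A' + m' + τ') + (x0 + B + A + m) * τ' + B * (A' + m') + A * (B' + m') + m * (B' + A'))
      - (x0 * A' + A * y0 + A * A') * (x0 * B' + B * y0 + B * B') = κz := by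
    rw [hκz, hzτ, hzB, hzA, hx0, hy0]; ring
  have hκz0 : 0 ≤ κz := by
    rw [← eκz]
    exact comp_harris x0 B A m τ y0 B' A' m' τ' h0 hB hA hm hτ h0' hB' hA' hm' hτ'
      (by have e : (x0 + m) * τ - A * B = τ - (τ + B) * (τ + A) := by rw [hx0]; ring
          rw [e]; linarith [hH])
      (by have e : (y0 + m') * τ' - A' * B' = τ' - (τ' + B') * (τ' + A') := by rw [hy0]; ring
          rw [e]; linarith [hH'])
  -- the transfer inequality: O_y O_x² κ_z ≤ O_x² (O_y² κ₁) + O_y Q_x (O_x² κ₂)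
  have ht := transfer_kappa_le x0 B A m τ y0 B' A' m' τ' h0 hB hA hm h0' hB' hA' hm' hτ' hsum hsum'
  have e1 : (y0 + m') ^ 2 * (x0 + m) * τ + (y0 + m') * m' * (x0 + m) * (A + B) - y0 ^ 2 * A * B = (y0 + m') ^ 2 * κ₁ := by
    rw [hκ₁, hx0]
    linear_combination (-(y0 + m') * ((1 - B - A - m - τ) + m) * (A + B) - 2 * y0 * A * B + ((y0 + m') * w - m') * A * B) * hwO
  have e2 : (x0 + m) ^ 2 * (y0 + m') * τ' + (x0 + m) * m * (y0 + m') * (A' + B') - x0 ^ 2 * A' * B' = (x0 + m) ^ 2 * κ₂ := by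
    rw [hκ₂, hy0]
    linear_combination (-(x0 + m) * ((1 - B' - A' - m' - τ') + m') * (A' + B') - 2 * x0 * A' * B' + ((x0 + m) * v - m) * A' * B') * hvO
  rw [e1, e2, eκz] at ht
  -- divide by O_y O_x² > 0 :  κ_z ≤ O_y κ₁ + Q_x κ₂
  obtain ⟨Q, hQ⟩ : ∃ t : ℝ, t = (x0 + m + A) * (x0 + m + B) := ⟨_, rfl⟩
  rw [← hQ] at ht
  have hQ0 : 0 ≤ Q := by rw [hQ]; positivity
  have hpos : 0 < (y0 + m') * (x0 + m) ^ 2 := by positivity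
  have ha : κz ≤ (y0 + m') * κ₁ + Q * κ₂ := by
    have : (y0 + m') * (x0 + m) ^ 2 * κz ≤ (y0 + m') * (x0 + m) ^ 2 * ((y0 + m') * κ₁ + Q * κ₂) := by
      calc (y0 + m') * (x0 + m) ^ 2 * κz ≤ (x0 + m) ^ 2 * ((y0 + m') ^ 2 * κ₁) + (y0 + m') * Q * ((x0 + m) ^ 2 * κ₂) := ht
        _ = (y0 + m') * (x0 + m) ^ 2 * ((y0 + m') * κ₁ + Q * κ₂) := by ring
    exact le_of_mul_le_mul_left this hpos
  -- the m identities: O_y m_{x′} = z_m = O_x m_{y′}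
  have em1 : (y0 + m') * (m + w * x0) = zm := by
    rw [hzm]; linear_combination x0 * hwO
  have em2 : (x0 + m) * (m' + v * y0) = zm := by
    rw [hzm]; linear_combination y0 * hvO
  -- X := O_y κ₁, Y := Q κ₂ :  X² ≤ C z_m P₁,  Y² ≤ C z_m P₂
  have hzm0 : 0 ≤ zm := by rw [hzm]; positivity
  have hP₁0 : 0 ≤ P₁ := by rw [hP₁]; rw [← hw]; positivity
  have hP₂0 : 0 ≤ P₂ := by rw [hP₂]; rw [← hv]; positivity
  have hX2 : ((y0 + m') * κ₁) ^ 2 ≤ 28 / 27 * zm * P₁ := by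
    have h1' : κ₁ ^ 2 ≤ 28 / 27 * ((τ + B + w * A) * (τ + A + w * B)) * (m + w * x0) := h1
    have := mul_le_mul_of_nonneg_left h1' (sq_nonneg (y0 + m'))
    calc ((y0 + m') * κ₁) ^ 2 = (y0 + m') ^ 2 * κ₁ ^ 2 := by ring
      _ ≤ (y0 + m') ^ 2 * (28 / 27 * ((τ + B + w * A) * (τ + A + w * B)) * (m + w * x0)) := this
      _ = 28 / 27 * ((y0 + m') * (m + w * x0)) * ((y0 + m') * ((τ + B + w * A) * (τ + A + w * B))) := by ring
      _ = 28 / 27 * zm * P₁ := by rw [em1, hP₁, ← hw]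
  have hY2 : (Q * κ₂) ^ 2 ≤ 28 / 27 * zm * P₂ := by
    have h2' : κ₂ ^ 2 ≤ 28 / 27 * ((τ' + B' + v * A') * (τ' + A' + v * B')) * (m' + v * y0) := h2
    have := mul_le_mul_of_nonneg_left h2' (sq_nonneg Q)
    have eP₂ : P₂ = Q ^ 2 * ((τ' + B' + v * A') * (τ' + A' + v * B')) / (x0 + m) := by rw [hP₂, hQ, ← hv]
    calc (Q * κ₂) ^ 2 = Q ^ 2 * κ₂ ^ 2 := by ring
      _ ≤ Q ^ 2 * (28 / 27 * ((τ' + B' + v * A') * (τ' + A' + v * B')) * (m' + v * y0)) := this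
      _ = 28 / 27 * ((x0 + m) * (m' + v * y0)) * (Q ^ 2 * ((τ' + B' + v * A') * (τ' + A' + v * B')) / (x0 + m)) := by
          field_simp
      _ = 28 / 27 * zm * P₂ := by rw [em2, eP₂]
  -- Cauchy–Schwarz assembly
  have hX0 : 0 ≤ (y0 + m') * κ₁ := by positivity
  have hY0 : 0 ≤ Q * κ₂ := by positivity
  have hc0 : 0 ≤ 28 / 27 * zm := by positivity
  have hXle : (y0 + m') * κ₁ ≤ Real.sqrt (28 / 27 * zm) * Real.sqrt P₁ := by
    rw [← Real.sqrt_mul hc0, ← Real.sqrt_sq hX0]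
    exact Real.sqrt_le_sqrt (by linarith [hX2])
  have hYle : Q * κ₂ ≤ Real.sqrt (28 / 27 * zm) * Real.sqrt P₂ := by
    rw [← Real.sqrt_mul hc0, ← Real.sqrt_sq hY0]
    exact Real.sqrt_le_sqrt (by linarith [hY2])
  have hsum_le : κz ≤ Real.sqrt (28 / 27 * zm) * (Real.sqrt P₁ + Real.sqrt P₂) := by
    calc κz ≤ (y0 + m') * κ₁ + Q * κ₂ := ha
      _ ≤ Real.sqrt (28 / 27 * zm) * Real.sqrt P₁ + Real.sqrt (28 / 27 * zm) * Real.sqrt P₂ := add_le_add hXle hYle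
      _ = Real.sqrt (28 / 27 * zm) * (Real.sqrt P₁ + Real.sqrt P₂) := by ring
  have hS0 : 0 ≤ Real.sqrt (28 / 27 * zm) * (Real.sqrt P₁ + Real.sqrt P₂) := by positivity
  have hsq : κz ^ 2 ≤ (Real.sqrt (28 / 27 * zm) * (Real.sqrt P₁ + Real.sqrt P₂)) ^ 2 := pow_le_pow_left₀ hκz0 hsum_le 2
  rw [← hκz]
  calc κz ^ 2 ≤ (Real.sqrt (28 / 27 * zm) * (Real.sqrt P₁ + Real.sqrt P₂)) ^ 2 := hsq
    _ = (Real.sqrt (28 / 27 * zm)) ^ 2 * (Real.sqrt P₁ + Real.sqrt P₂) ^ 2 := by ring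
    _ = 28 / 27 * zm * (Real.sqrt P₁ + Real.sqrt P₂) ^ 2 := by rw [Real.sq_sqrt hc0]
    _ ≤ 28 / 27 * zm * ((zτ + zB) * (zτ + zA)) := mul_le_mul_of_nonneg_left hb hc0
    _ = 28 / 27 * ((zτ + zB) * (zτ + zA)) * zm := by ring

end APL

end Summit.CriticalPhenomena.PercolationContinuityZ3.Theorems
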